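import Summits.RiemannHypothesis.RiemannHypothesis.Theorems.EtaLeadingQuarterWeakLockingLayerZeroSide
import Literature.NumberTheory.LFunctions.SchoenfeldZeroSums
import Summits.RiemannHypothesis.RiemannHypothesis.Theorems.SoloInformedQuasiWeilCell

/-!
# Real Dirichlet polynomials at the zeros of `ζ`, II: the middle range
(route EtaLeadingQuarter, item `WeakLockingLayer`, stmt-RiemannHypothesis-21792)

For `D_a(t) = ∑_{k ≤ M} a_k k^{-it}` (real `a_k`) and heights `2 ≤ X ≤ T₂`:
`∑_{X < |γ| ≤ T₂} m(ρ) γ^{-2} ‖D_a(γ)‖²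
   ≤ 2 X^{-2} · 2A log(T₂ + 4) · (5(T₂+1) + 18M) · (3/2 + (log M)²/2) · ∑_k a_k²`,
where `N(t+1) − N(t) ≤ A log(t+2)` is the local zero density (tree
`Montgomery.exists_zetaZeroCount_add_one_sub_le`). Ingredients: conjugation symmetry of the
zeros (tree `sum_sdiff_zerosUpTo_eq_two_mul`), Gallagher's unit cell
`‖f(γ)‖² ≤ ∫_{γ−1/2}^{γ+1/2} (3/2‖f‖² + 1/2‖f'‖²)` (tree `Theorems.norm_sq_le_integral_cell`), the
local count, and the tree's mean value theorem `dirichletPolynomial_meanSquare_le`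
(`∫_{-T}^{T} ‖D‖² ≤ (5T + 18M) ∑ |a_k|²`). All proved, RH-free.
Nothing here bears on the truth of RH.
-/

noncomputable section

open Complex MeasureTheory Set Filter Finset intervalIntegral
open scoped Real Topology ComplexConjugate

set_option linter.dupNamespace false  -- the mandated namespace repeats `RiemannHypothesis`

namespace Summit.RiemannHypothesis.RiemannHypothesis.Theorems.EtaLeadingQuarter.ZeroSide

open Literature.NumberTheory.LFunctions NicolasJExplicit SchoenfeldBound ZetaZeroTails

/-! ## Mean values of `D_a` and `D_a'` -/

/-- `∫_{-T}^{T} ‖D_a‖² ≤ (5T + 18M) ∑ a_k²` (tree `dirichletPolynomial_meanSquare_le`). [folklore] -/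
theorem meanSquare_dirPoly_le (a : ℕ → ℝ) (M : ℕ) {T : ℝ} (hT : 0 < T) :
    ∫ t in -T..T, ‖dirPoly a M t‖ ^ 2 ≤ (5 * T + 18 * M) * ∑ k ∈ Finset.Icc 1 M, a k ^ 2 := by
  have h := dirichletPolynomial_meanSquare_le (fun k ↦ ((a k : ℝ) : ℂ)) M hT
  have e : ∑ k ∈ Finset.Icc 1 M, ‖((a k : ℝ) : ℂ)‖ ^ 2 = ∑ k ∈ Finset.Icc 1 M, a k ^ 2 :=
    Finset.sum_congr rfl fun k _ ↦ by rw [Complex.norm_real, Real.norm_eq_abs, sq_abs]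
  rw [e] at h
  exact h

/-- `∫_{-T}^{T} ‖D_a'‖² ≤ (5T + 18M) (log M)² ∑ a_k²`. [folklore] -/
theorem meanSquare_dirPolyDeriv_le (a : ℕ → ℝ) (M : ℕ) {T : ℝ} (hT : 0 < T) :
    ∫ t in -T..T, ‖dirPolyDeriv a M t‖ ^ 2 ≤
      (5 * T + 18 * M) * (Real.log M ^ 2 * ∑ k ∈ Finset.Icc 1 M, a k ^ 2) := by
  have h := dirichletPolynomial_meanSquare_le (fun k ↦ ((a k : ℝ) : ℂ) * (-((Real.log k : ℝ) : ℂ) * I)) M hT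
  have e : ∑ k ∈ Finset.Icc 1 M, ‖((a k : ℝ) : ℂ) * (-((Real.log k : ℝ) : ℂ) * I)‖ ^ 2 ≤
      Real.log M ^ 2 * ∑ k ∈ Finset.Icc 1 M, a k ^ 2 := by
    rw [Finset.mul_sum]
    refine Finset.sum_le_sum fun k hk ↦ ?_
    rw [Finset.mem_Icc] at hk
    have hk1 : (1 : ℝ) ≤ k := by exact_mod_cast hk.1
    have hkM : (k : ℝ) ≤ M := by exact_mod_cast hk.2
    have hl0 : 0 ≤ Real.log k := Real.log_nonneg hk1
    have hlM : Real.log k ≤ Real.log M := Real.log_le_log (by linarith) hkM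
    rw [norm_mul, norm_mul, norm_neg, Complex.norm_I, mul_one, Complex.norm_real, Complex.norm_real,
      Real.norm_eq_abs, Real.norm_eq_abs, abs_of_nonneg hl0, mul_pow, sq_abs]
    rw [mul_comm]
    exact mul_le_mul_of_nonneg_right (pow_le_pow_left₀ hl0 hlM 2) (sq_nonneg _)
  have hK : 0 ≤ 5 * T + 18 * (M : ℝ) := by positivity
  exact h.trans (mul_le_mul_of_nonneg_left e hK)

/-! ## The local zero count around a point -/

/-- For `2 ≤ X` and any real `v`: the zeros `ρ ∈ zerosBetween X T₂` with
`v ∈ (Im ρ − 1/2, Im ρ + 1/2]` have total multiplicity `≤ 2A log(T₂ + 4)`, given the local density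
`N(t+1) − N(t) ≤ A log(t+2)` (`t ≥ 0`). [folklore] -/
theorem localCount_le {A : ℝ} (hA0 : 0 ≤ A)
    (hA : ∀ t : ℝ, 0 ≤ t → (zetaZeroCount (t + 1) : ℝ) - zetaZeroCount t ≤ A * Real.log (t + 2))
    {X T₂ : ℝ} (hX : 2 ≤ X) (hXT : X ≤ T₂) (v : ℝ) :
    ∑ ρ ∈ (zerosBetween X T₂).filter (fun ρ : ℂ ↦ v ∈ Set.Ioc (ρ.im - 1 / 2) (ρ.im + 1 / 2)),
        (riemannZetaZeroOrder ρ : ℝ) ≤ 2 * A * Real.log (T₂ + 4) := by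
  classical
  have hX0 : (0 : ℝ) ≤ X := by linarith
  have hd0 : 0 ≤ 2 * A * Real.log (T₂ + 4) := by
    have : 0 ≤ Real.log (T₂ + 4) := Real.log_nonneg (by linarith)
    positivity
  by_cases hv : 3 / 2 ≤ v ∧ v ≤ T₂ + 1 / 2
  · obtain ⟨hv1, hv2⟩ := hv
    have hsub : (zerosBetween X T₂).filter (fun ρ : ℂ ↦ v ∈ Set.Ioc (ρ.im - 1 / 2) (ρ.im + 1 / 2)) ⊆
        zerosBetween (v - 1) (v + 1) := by
      intro ρ hρ
      rw [Finset.mem_filter, mem_zerosBetween hX0, Set.mem_Ioc] at hρ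
      obtain ⟨⟨hz, h1, h2, -, -⟩, h5, h6⟩ := hρ
      rw [mem_zerosBetween (by linarith)]
      exact ⟨hz, h1, h2, by linarith, by linarith⟩
    calc ∑ ρ ∈ (zerosBetween X T₂).filter (fun ρ : ℂ ↦ v ∈ Set.Ioc (ρ.im - 1 / 2) (ρ.im + 1 / 2)),
          (riemannZetaZeroOrder ρ : ℝ)
        ≤ ∑ ρ ∈ zerosBetween (v - 1) (v + 1), (riemannZetaZeroOrder ρ : ℝ) :=
          Finset.sum_le_sum_of_subset_of_nonneg hsub fun ρ hρ _ ↦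
            zeroOrder_nonneg_of_mem_zerosBetween (by linarith) hρ
      _ = (zetaZeroCount (v + 1) : ℝ) - zetaZeroCount (v - 1) := (zetaZeroCount_sub_eq_sum (by linarith)).symm
      _ = ((zetaZeroCount (v + 1) : ℝ) - zetaZeroCount v) + ((zetaZeroCount (v - 1 + 1) : ℝ) - zetaZeroCount (v - 1)) := by
          rw [sub_add_cancel]; ring
      _ ≤ A * Real.log (v + 2) + A * Real.log (v - 1 + 2) := add_le_add (hA v (by linarith)) (hA (v - 1) (by linarith))
      _ ≤ A * Real.log (T₂ + 4) + A * Real.log (T₂ + 4) := by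
          have h1 : Real.log (v + 2) ≤ Real.log (T₂ + 4) := Real.log_le_log (by linarith) (by linarith)
          have h2 : Real.log (v - 1 + 2) ≤ Real.log (T₂ + 4) := Real.log_le_log (by linarith) (by linarith)
          exact add_le_add (mul_le_mul_of_nonneg_left h1 hA0) (mul_le_mul_of_nonneg_left h2 hA0)
      _ = 2 * A * Real.log (T₂ + 4) := by ring
  · -- the filter is empty
    have hempty : (zerosBetween X T₂).filter (fun ρ : ℂ ↦ v ∈ Set.Ioc (ρ.im - 1 / 2) (ρ.im + 1 / 2)) = ∅ := by
      rw [Finset.filter_eq_empty_iff]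
      intro ρ hρ hmem
      rw [mem_zerosBetween hX0] at hρ
      obtain ⟨-, -, -, h3, h4⟩ := hρ
      rw [Set.mem_Ioc] at hmem
      apply hv
      constructor <;> linarith [hmem.1, hmem.2]
    rw [hempty, Finset.sum_empty]
    exact hd0

/-! ## The middle range -/

/-- **One-sided cell bound with local count.** For `2 ≤ X ≤ T₂` and the local density constant `A`:
`∑_{X < Im ρ ≤ T₂} m(ρ) ‖D_a(Im ρ)‖² ≤ 2A log(T₂+4) · ∫_{-(T₂+1)}^{T₂+1} (3/2 ‖D_a‖² + 1/2 ‖D_a'‖²)`.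
[folklore] -/
theorem sum_zerosBetween_norm_sq_le {A : ℝ} (hA0 : 0 ≤ A)
    (hA : ∀ t : ℝ, 0 ≤ t → (zetaZeroCount (t + 1) : ℝ) - zetaZeroCount t ≤ A * Real.log (t + 2))
    (a : ℕ → ℝ) (M : ℕ) {X T₂ : ℝ} (hX : 2 ≤ X) (hXT : X ≤ T₂) :
    ∑ ρ ∈ zerosBetween X T₂, (riemannZetaZeroOrder ρ : ℝ) * ‖dirPoly a M ρ.im‖ ^ 2 ≤
      2 * A * Real.log (T₂ + 4) *
        ∫ t in (-(T₂ + 1))..(T₂ + 1), (3 / 2 * ‖dirPoly a M t‖ ^ 2 + 1 / 2 * ‖dirPolyDeriv a M t‖ ^ 2) := by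
  classical
  have hX0 : (0 : ℝ) ≤ X := by linarith
  set B := zerosBetween X T₂ with hB
  set d : ℝ := 2 * A * Real.log (T₂ + 4) with hd
  set R : ℝ := T₂ + 1 with hR
  set ψ : ℝ → ℝ := fun t ↦ 3 / 2 * ‖dirPoly a M t‖ ^ 2 + 1 / 2 * ‖dirPolyDeriv a M t‖ ^ 2 with hψ
  have hψc : Continuous ψ :=
    (continuous_const.mul ((continuous_dirPoly a M).norm.pow 2)).add
      (continuous_const.mul ((continuous_dirPolyDeriv a M).norm.pow 2))
  have hψ0 : ∀ t, 0 ≤ ψ t := fun t ↦ by positivity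
  -- the truncated (integrable) majorant
  set ψR : ℝ → ℝ := (Icc (-R) R).indicator ψ with hψR
  have hψR0 : ∀ t, 0 ≤ ψR t := fun t ↦ Set.indicator_nonneg (fun t _ ↦ hψ0 t) t
  have hψRi : Integrable ψR :=
    (hψc.continuousOn.integrableOn_compact isCompact_Icc).integrable_indicator measurableSet_Icc
  have hd0 : 0 ≤ d := by
    have : 0 ≤ Real.log (T₂ + 4) := Real.log_nonneg (by linarith)
    rw [hd]; positivity
  have hw : ∀ ρ ∈ B, (0 : ℝ) ≤ riemannZetaZeroOrder ρ := fun ρ hρ ↦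
    zeroOrder_nonneg_of_mem_zerosBetween hX0 hρ
  -- pointwise cell bound, written with indicators of `ψR`
  have hcell : ∀ ρ ∈ B, ‖dirPoly a M ρ.im‖ ^ 2 ≤ ∫ v, (Set.Ioc (ρ.im - 1 / 2) (ρ.im + 1 / 2)).indicator ψR v := by
    intro ρ hρ
    obtain ⟨-, -, -, h3, h4⟩ := (mem_zerosBetween hX0).1 hρ
    have hc := Theorems.norm_sq_le_integral_cell (hasDerivAt_dirPoly a M) (continuous_dirPolyDeriv a M) ρ.im
    rw [MeasureTheory.integral_indicator measurableSet_Ioc, ← integral_of_le (by linarith)]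
    refine hc.trans_eq (intervalIntegral.integral_congr fun v hv ↦ ?_)
    rw [Set.uIcc_of_le (by linarith)] at hv
    have hvR : v ∈ Icc (-R) R := ⟨by linarith [hv.1], by linarith [hv.2]⟩
    simp only [hψR, Set.indicator_of_mem hvR, hψ]
  have hii : ∀ ρ ∈ B, Integrable fun v ↦
      (riemannZetaZeroOrder ρ : ℝ) * (Set.Ioc (ρ.im - 1 / 2) (ρ.im + 1 / 2)).indicator ψR v :=
    fun ρ _ ↦ (hψRi.indicator measurableSet_Ioc).const_mul _
  -- the local count, pointwise in `v`
  have hpt : ∀ v, ∑ ρ ∈ B, (riemannZetaZeroOrder ρ : ℝ) * (Set.Ioc (ρ.im - 1 / 2) (ρ.im + 1 / 2)).indicator ψR v ≤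
      d * ψR v := by
    intro v
    have e : ∀ ρ ∈ B, (riemannZetaZeroOrder ρ : ℝ) * (Set.Ioc (ρ.im - 1 / 2) (ρ.im + 1 / 2)).indicator ψR v =
        if v ∈ Set.Ioc (ρ.im - 1 / 2) (ρ.im + 1 / 2) then (riemannZetaZeroOrder ρ : ℝ) * ψR v else 0 := by
      intro ρ _
      rw [Set.indicator_apply]
      split_ifs <;> simp
    rw [Finset.sum_congr rfl e, ← Finset.sum_filter, ← Finset.sum_mul]
    exact mul_le_mul_of_nonneg_right (localCount_le hA0 hA hX hXT v) (hψR0 v)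
  -- `∫ ψR = ∫_{-R}^{R} ψ`
  have hint : ∫ v, ψR v = ∫ t in (-R)..R, ψ t := by
    rw [hψR, MeasureTheory.integral_indicator measurableSet_Icc, integral_of_le (by rw [hR]; linarith),
      integral_Icc_eq_integral_Ioc]
  calc ∑ ρ ∈ B, (riemannZetaZeroOrder ρ : ℝ) * ‖dirPoly a M ρ.im‖ ^ 2
      ≤ ∑ ρ ∈ B, (riemannZetaZeroOrder ρ : ℝ) * ∫ v, (Set.Ioc (ρ.im - 1 / 2) (ρ.im + 1 / 2)).indicator ψR v :=
        Finset.sum_le_sum fun ρ hρ ↦ mul_le_mul_of_nonneg_left (hcell ρ hρ) (hw ρ hρ)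
    _ = ∫ v, ∑ ρ ∈ B, (riemannZetaZeroOrder ρ : ℝ) * (Set.Ioc (ρ.im - 1 / 2) (ρ.im + 1 / 2)).indicator ψR v := by
        rw [integral_finsetSum _ hii]
        refine Finset.sum_congr rfl fun ρ _ ↦ ?_
        rw [MeasureTheory.integral_const_mul]
    _ ≤ ∫ v, d * ψR v := integral_mono (integrable_finsetSum _ hii) (hψRi.const_mul d) hpt
    _ = d * ∫ t in (-R)..R, ψ t := by rw [MeasureTheory.integral_const_mul, hint]

/-- **Middle range.** For real coefficients `a`, `2 ≤ X ≤ T₂` and the local density constant `A`: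
`∑_{X < |γ| ≤ T₂} m γ^{-2} ‖D_a(γ)‖²
  ≤ 2 X^{-2} · 2A log(T₂+4) · (5(T₂+1) + 18M) · (3/2 + (log M)²/2) · ∑ a_k²`. [folklore] -/
theorem midRange_le {A : ℝ} (hA0 : 0 ≤ A)
    (hA : ∀ t : ℝ, 0 ≤ t → (zetaZeroCount (t + 1) : ℝ) - zetaZeroCount t ≤ A * Real.log (t + 2))
    (a : ℕ → ℝ) (M : ℕ) {X T₂ : ℝ} (hX : 2 ≤ X) (hXT : X ≤ T₂) :
    ∑ ρ ∈ zerosUpTo T₂ \ zerosUpTo X,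
        (riemannZetaZeroOrder (ρ : ℂ) : ℝ) / (ρ : ℂ).im ^ 2 * ‖dirPoly a M (ρ : ℂ).im‖ ^ 2 ≤
      2 * (X ^ 2)⁻¹ * (2 * A * Real.log (T₂ + 4)) *
        ((5 * (T₂ + 1) + 18 * M) * ((3 / 2 + Real.log M ^ 2 / 2) * ∑ k ∈ Finset.Icc 1 M, a k ^ 2)) := by
  classical
  have hX0 : (0 : ℝ) ≤ X := by linarith
  -- two-sided sum = 2 × one-sided sum
  have h2 := sum_sdiff_zerosUpTo_eq_two_mul (T₁ := X) (T₂ := T₂) hX0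
    (g := fun z ↦ (riemannZetaZeroOrder z : ℝ) / z.im ^ 2 * ‖dirPoly a M z.im‖ ^ 2) (fun z ↦ by
      simp only [riemannZetaZeroOrder_conj_holds z, Complex.conj_im, neg_sq, norm_dirPoly_neg])
  rw [h2]
  -- `1/γ² ≤ 1/X²` on the one-sided block
  have hblock : ∑ ρ ∈ zerosBetween X T₂, (riemannZetaZeroOrder ρ : ℝ) / ρ.im ^ 2 * ‖dirPoly a M ρ.im‖ ^ 2 ≤
      (X ^ 2)⁻¹ * ∑ ρ ∈ zerosBetween X T₂, (riemannZetaZeroOrder ρ : ℝ) * ‖dirPoly a M ρ.im‖ ^ 2 := by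
    rw [Finset.mul_sum]
    refine Finset.sum_le_sum fun ρ hρ ↦ ?_
    obtain ⟨-, -, -, h3, -⟩ := (mem_zerosBetween hX0).1 hρ
    have hm := zeroOrder_nonneg_of_mem_zerosBetween hX0 hρ
    have hγ : X ^ 2 ≤ ρ.im ^ 2 := pow_le_pow_left₀ hX0 h3.le 2
    have hX2 : 0 < X ^ 2 := by positivity
    calc (riemannZetaZeroOrder ρ : ℝ) / ρ.im ^ 2 * ‖dirPoly a M ρ.im‖ ^ 2
        = (ρ.im ^ 2)⁻¹ * ((riemannZetaZeroOrder ρ : ℝ) * ‖dirPoly a M ρ.im‖ ^ 2) := by ring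
      _ ≤ (X ^ 2)⁻¹ * ((riemannZetaZeroOrder ρ : ℝ) * ‖dirPoly a M ρ.im‖ ^ 2) :=
        mul_le_mul_of_nonneg_right (inv_anti₀ hX2 hγ) (mul_nonneg hm (sq_nonneg _))
  have hcell := sum_zerosBetween_norm_sq_le hA0 hA a M hX hXT
  -- mean values
  have hR : 0 < T₂ + 1 := by linarith
  have hψi1 : IntervalIntegrable (fun t ↦ 3 / 2 * ‖dirPoly a M t‖ ^ 2) volume (-(T₂ + 1)) (T₂ + 1) :=
    (continuous_const.mul ((continuous_dirPoly a M).norm.pow 2)).intervalIntegrable _ _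
  have hψi2 : IntervalIntegrable (fun t ↦ 1 / 2 * ‖dirPolyDeriv a M t‖ ^ 2) volume (-(T₂ + 1)) (T₂ + 1) :=
    (continuous_const.mul ((continuous_dirPolyDeriv a M).norm.pow 2)).intervalIntegrable _ _
  have hMV : ∫ t in (-(T₂ + 1))..(T₂ + 1), (3 / 2 * ‖dirPoly a M t‖ ^ 2 + 1 / 2 * ‖dirPolyDeriv a M t‖ ^ 2) ≤
      (5 * (T₂ + 1) + 18 * M) * ((3 / 2 + Real.log M ^ 2 / 2) * ∑ k ∈ Finset.Icc 1 M, a k ^ 2) := by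
    rw [intervalIntegral.integral_add hψi1 hψi2, intervalIntegral.integral_const_mul,
      intervalIntegral.integral_const_mul]
    have e1 := meanSquare_dirPoly_le a M hR
    have e2 := meanSquare_dirPolyDeriv_le a M hR
    nlinarith
  have hd0 : 0 ≤ 2 * A * Real.log (T₂ + 4) := by
    have : 0 ≤ Real.log (T₂ + 4) := Real.log_nonneg (by linarith)
    positivity
  have hX2 : 0 ≤ (X ^ 2)⁻¹ := by positivity
  calc 2 * ∑ ρ ∈ zerosBetween X T₂, (riemannZetaZeroOrder ρ : ℝ) / ρ.im ^ 2 * ‖dirPoly a M ρ.im‖ ^ 2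
      ≤ 2 * ((X ^ 2)⁻¹ * ∑ ρ ∈ zerosBetween X T₂, (riemannZetaZeroOrder ρ : ℝ) * ‖dirPoly a M ρ.im‖ ^ 2) :=
        by linarith
    _ ≤ 2 * ((X ^ 2)⁻¹ * (2 * A * Real.log (T₂ + 4) *
          ∫ t in (-(T₂ + 1))..(T₂ + 1), (3 / 2 * ‖dirPoly a M t‖ ^ 2 + 1 / 2 * ‖dirPolyDeriv a M t‖ ^ 2))) := by
        gcongr
    _ ≤ 2 * ((X ^ 2)⁻¹ * (2 * A * Real.log (T₂ + 4) *
          ((5 * (T₂ + 1) + 18 * M) * ((3 / 2 + Real.log M ^ 2 / 2) * ∑ k ∈ Finset.Icc 1 M, a k ^ 2)))) := by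
        gcongr
    _ = _ := by ring

end Summit.RiemannHypothesis.RiemannHypothesis.Theorems.EtaLeadingQuarter.ZeroSide

end
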